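import Summits.MatrixMultiplication.OmegaCensus.STPP222IcosetClassNoneK6Z33
import Summits.MatrixMultiplication.OmegaCensus.STPP222IcosetClassNoneK6Z11

/-!
# ω-census, icoset class negatives in the census's own wording: «every set is a coset of an order-2 subgroup»

HONEST FRAMING (pub-omega census; verbatim): lottery ticket; floor = certified bounds/negative ranges.
Census STRUCTURE bookkeeping (Q7; CLASS-INTERNAL negatives, nothing about unrestricted `(2,2,2)⁶` families, nothing about `ω`).

`Icoset.IsIcosetFamily` (the hypothesis of `no_icoset_pow6_F2cube_zmod7/9/3_sq/11`) asks every set to be `{(x,a), (x+s,a)}` with an involution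
`(s, 0)`, `s ∈ V ∖ {0}`.  The cell's class definition (`ICOSET-NOTE.md`, ENG2 gen 27) is «every 2-set is a coset `{g, g + w}` of an order-2 subgroup,
`w ≠ 0`, `w + w = 0`».  When `H` has no 2-torsion (e.g. `|H|` odd) the two agree: `w = (s, h)` with `w + w = 0` forces `h = 0`
(`Icoset.isIcosetFamily_of_involution_cosets`).  Hence the kernel class negatives in the census's wording: `no_involutionCoset_pow6_F2cube_zmod7 /
zmod9 / zmod3_sq / zmod11`.  Seat pub-omega-kernel-l4 (gen 19), 2026-08-27.
-/

namespace Summit.MatrixMultiplication.OmegaCensus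

open Literature.Computability.AlgebraicComplexity

namespace Icoset

variable {V H : Type*} [AddCommGroup V] [AddCommGroup H] [DecidableEq V] [DecidableEq H]

/-- «Every set of the family is a coset `{g, g + w}` of an order-2 subgroup `⟨w⟩` (`w ≠ 0`, `w + w = 0`)» — the census's class definition.
[cite: CohnKleinbergSzegedyUmans2005, Def. 5.1] -/
def IsInvolutionCosetFamily {K : ℕ} (A B C : Fin K → Finset (V × H)) : Prop :=
  ∀ t, (∃ g w : V × H, w ≠ 0 ∧ w + w = 0 ∧ A t = {g, g + w}) ∧ (∃ g w : V × H, w ≠ 0 ∧ w + w = 0 ∧ B t = {g, g + w}) ∧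
    (∃ g w : V × H, w ≠ 0 ∧ w + w = 0 ∧ C t = {g, g + w})

/-- Without 2-torsion in `H`, an order-2 element of `V × H` is `(s, 0)` and its coset through `g` is `pair g.1 s g.2`. [folklore] -/
theorem coset_eq_pair (hH : ∀ h : H, h + h = 0 → h = 0) {g w : V × H} (hw0 : w ≠ 0) (hw : w + w = 0) :
    ∃ s : V, s ≠ 0 ∧ ({g, g + w} : Finset (V × H)) = pair g.1 s g.2 := by
  obtain ⟨s, h⟩ := w
  have hh : h = 0 := hH h (by simpa using congrArg Prod.snd hw)
  subst hh
  refine ⟨s, fun hs => hw0 (by rw [hs]; rfl), ?_⟩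
  have e : g + (s, 0) = (g.1 + s, g.2) := Prod.ext rfl (add_zero _)
  rw [e, pair]

/-- **The two class definitions agree without 2-torsion in `H`.** [folklore] -/
theorem isIcosetFamily_of_involution_cosets (hH : ∀ h : H, h + h = 0 → h = 0) {K : ℕ} {A B C : Fin K → Finset (V × H)}
    (hF : IsInvolutionCosetFamily A B C) : IsIcosetFamily A B C := by
  intro t
  obtain ⟨⟨g₁, w₁, h₁0, h₁, e₁⟩, ⟨g₂, w₂, h₂0, h₂, e₂⟩, ⟨g₃, w₃, h₃0, h₃, e₃⟩⟩ := hF t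
  obtain ⟨s₁, hs₁, f₁⟩ := coset_eq_pair hH (g := g₁) h₁0 h₁
  obtain ⟨s₂, hs₂, f₂⟩ := coset_eq_pair hH (g := g₂) h₂0 h₂
  obtain ⟨s₃, hs₃, f₃⟩ := coset_eq_pair hH (g := g₃) h₃0 h₃
  exact ⟨⟨_, _, _, hs₁, e₁.trans f₁⟩, ⟨_, _, _, hs₂, e₂.trans f₂⟩, ⟨_, _, _, hs₃, e₃.trans f₃⟩⟩

end Icoset

/-- `ℤ₇`, `ℤ₉`, `ℤ₁₁`, `ℤ₃ × ℤ₃` have no 2-torsion. [folklore] -/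
theorem no_two_torsion_small :
    (∀ h : ZMod 7, h + h = 0 → h = 0) ∧ (∀ h : ZMod 9, h + h = 0 → h = 0) ∧ (∀ h : ZMod 11, h + h = 0 → h = 0) ∧
      (∀ h : ZMod 3 × ZMod 3, h + h = 0 → h = 0) := by
  refine ⟨by decide, by decide, by decide, by decide⟩

/-- **`𝔽₂³ × ℤ₇`: no `(2,2,2)⁶` STPP family all of whose sets are cosets of order-2 subgroups** — KERNEL, class-internal.
[cite: CohnKleinbergSzegedyUmans2005, Def. 5.1] -/
theorem no_involutionCoset_pow6_F2cube_zmod7 :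
    ¬ ∃ A B C : Fin 6 → Finset ((ZMod 2 × ZMod 2 × ZMod 2) × ZMod 7), Icoset.IsInvolutionCosetFamily A B C ∧ IsSTPP A B C :=
  fun ⟨A, B, C, hF, hS⟩ => no_icoset_pow6_F2cube_zmod7 ⟨A, B, C, Icoset.isIcosetFamily_of_involution_cosets no_two_torsion_small.1 hF, hS⟩

/-- **`𝔽₂³ × ℤ₉`: no `(2,2,2)⁶` STPP family all of whose sets are cosets of order-2 subgroups** — KERNEL, class-internal.
[cite: CohnKleinbergSzegedyUmans2005, Def. 5.1] -/
theorem no_involutionCoset_pow6_F2cube_zmod9 :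
    ¬ ∃ A B C : Fin 6 → Finset ((ZMod 2 × ZMod 2 × ZMod 2) × ZMod 9), Icoset.IsInvolutionCosetFamily A B C ∧ IsSTPP A B C :=
  fun ⟨A, B, C, hF, hS⟩ => no_icoset_pow6_F2cube_zmod9 ⟨A, B, C, Icoset.isIcosetFamily_of_involution_cosets no_two_torsion_small.2.1 hF, hS⟩

/-- **`𝔽₂³ × ℤ₃²`: no `(2,2,2)⁶` STPP family all of whose sets are cosets of order-2 subgroups** — KERNEL, class-internal.
[cite: CohnKleinbergSzegedyUmans2005, Def. 5.1] -/
theorem no_involutionCoset_pow6_F2cube_zmod3_sq :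
    ¬ ∃ A B C : Fin 6 → Finset ((ZMod 2 × ZMod 2 × ZMod 2) × (ZMod 3 × ZMod 3)),
      Icoset.IsInvolutionCosetFamily A B C ∧ IsSTPP A B C :=
  fun ⟨A, B, C, hF, hS⟩ =>
    no_icoset_pow6_F2cube_zmod3_sq ⟨A, B, C, Icoset.isIcosetFamily_of_involution_cosets no_two_torsion_small.2.2.2 hF, hS⟩

/-- **`𝔽₂³ × ℤ₁₁`: no `(2,2,2)⁶` STPP family all of whose sets are cosets of order-2 subgroups** — KERNEL, class-internal (the P-016.1 cell).
[cite: CohnKleinbergSzegedyUmans2005, Def. 5.1] -/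
theorem no_involutionCoset_pow6_F2cube_zmod11 :
    ¬ ∃ A B C : Fin 6 → Finset ((ZMod 2 × ZMod 2 × ZMod 2) × ZMod 11), Icoset.IsInvolutionCosetFamily A B C ∧ IsSTPP A B C :=
  fun ⟨A, B, C, hF, hS⟩ =>
    no_icoset_pow6_F2cube_zmod11 ⟨A, B, C, Icoset.isIcosetFamily_of_involution_cosets no_two_torsion_small.2.2.1 hF, hS⟩

end Summit.MatrixMultiplication.OmegaCensus
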